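import Summits.AnomalousDissipation.AnomalousDissipation.Theorems.BaireTransferRobustLoudUpgradeStubSteadyStratumClosed

/-!
# Stub `stub_lscInterior` of the line `malkin-cone-group-orbits`
# (crux stmt-AnomalousDissipation-1144, lead c15, wave 2): generic persistence at a point of
# lower hemicontinuity of the steady correspondence

At a coefficient vector `c ∈ P_S` where the steady correspondence of the stratum `n`,
`Φₙ(c') = {(ν, U) : ν ∈ [1/(n+1), n], ‖∇U‖² ≤ n², U ∈ H a steady weak solution of NS_ν(f_{c'})}`,
is LOWER hemicontinuous, every mean-zero classical steady witness `(ν, u, p)` of `c` inside the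
stratum (`1/(n+1) ≤ ν ≤ n`, `‖∇u‖² ≤ n²`) with strict budgets (`meanEnergy < E`,
`meanDissipation > ε`) at a viscosity `ν ∈ (0,a)` makes `c` an INTERIOR point of `loud S a E ε`.

Proof.  (1) The classical witness is a steady weak solution `U ∈ V`
(`Category.exists_weak_of_isSteadyNSState`) with `‖U‖² = meanEnergy < E` and
`(U, f_c) = meanDissipation > ε`; the energy equation and `gradNormSq = eGradNormSq.toReal` on
smooth fields put `(ν, U)` in `Φₙ(c)`.  (2) The set
`O = (0,a) × {V : ‖V‖² < E, ε + δ < ⟪V, f_c⟫}` (`2δ` = the dissipation slack) is open in `ℝ × H`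
and meets `Φₙ(c)`.  (3) Lower hemicontinuity: `Φₙ(c') ∩ O ≠ ∅` for `c'` near `c`; continuity of
`c' ↦ f_{c'}` in `L²` (`continuous_toLp_force`) and Cauchy–Schwarz on the ball `‖V‖ < √E` move
`⟪V, f_{c'}⟫` by less than `δ`.  (4) A point `(ν', V) ∈ Φₙ(c') ∩ O` is a steady weak solution in
`V` (finite enstrophy), whose classical mean-zero representative
(`CensusInterior.exists_isSteadyNSState`) is a `1`-periodic loud witness of `c'`.
-/

-- `Summit.<Summit>.<Problem>` is the tree's mandated summit-side namespace (CONVENTIONS §2); for this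
-- single-conjunct summit the two coincide, so the duplicate is deliberate.
set_option linter.dupNamespace false

noncomputable section

open scoped BigOperators Topology InnerProductSpace RealInnerProductSpace ENNReal
open Filter Set Function TopologicalSpace MeasureTheory

namespace Summit.AnomalousDissipation.AnomalousDissipation.Theorems.RobustLoudUpgrade.Category

open Literature.Analysis.FunctionSpaces Literature.Analysis.FunctionSpaces.Torus
open Literature.Analysis.FluidPDE Literature.Analysis.FluidPDE.Torus
open Summit.AnomalousDissipation.AnomalousDissipation.Theses.BaireTransfer
open Summit.AnomalousDissipation.AnomalousDissipation.Theorems.DenseLoudDesignerForces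
open Summit.AnomalousDissipation.AnomalousDissipation.Theorems.RobustLoudUpgrade.CensusInterior

/-! ## §1 A classical witness in the stratum is a point of the steady correspondence -/

/-- A mean-zero classical steady state `(u, p)` of `NS_ν(f_c)` (`ν > 0`) with `‖∇u‖² ≤ n²` is a steady
weak solution `U ∈ V` with `‖∇U‖² ≤ n²` (in `ℝ≥0∞`), `meanEnergy = ‖U‖²` and
`meanDissipation = (U, f_c)`: the energy equation `ν‖∇U‖² = (U, f_c) = meanDissipation = ν‖∇u‖²`
and `gradNormSq u = (eGradNormSq u).toReal` for smooth `u`. [folklore] -/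
theorem exists_weak_of_isSteadyNSState_of_gradNormSq_le {S : Finset (Fin 3 → ℤ)} {c : Coeff S}
    {n : ℕ} {ν : ℝ} {u : UnitAddTorus (Fin 3) → EuclideanSpace ℝ (Fin 3)}
    {p : UnitAddTorus (Fin 3) → ℝ} (hν : 0 < ν) (hst : Torus.IsSteadyNSState ν (force S c) u p)
    (h0 : HasZeroMean u) (hg : gradNormSq u ≤ (n : ℝ) ^ 2) :
    ∃ U : energySpace (Fin 3), U.1 ∈ energySpaceV (Fin 3) ∧ IsSteadyWeakSolution ν (force S c) U ∧
      eGradNormSq (U.1 : UnitAddTorus (Fin 3) → EuclideanSpace ℝ (Fin 3)) ≤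
          ENNReal.ofReal ((n : ℝ) ^ 2) ∧
        meanEnergy (fun _ : ℝ => u) = ‖U‖ ^ 2 ∧
          meanDissipation ν (fun _ : ℝ => u) = pairing U.1 (force S c) := by
  obtain ⟨U, hV, hw, hE, hD⟩ := exists_weak_of_isSteadyNSState (isSmooth_force c) hst h0
  refine ⟨U, hV, hw, ?_, hE, hD⟩
  have hu : IsSmooth u := hst.smooth_velocity.isSmooth_slice (mem_univ 0)
  have hfin : eGradNormSq (U.1 : UnitAddTorus (Fin 3) → EuclideanSpace ℝ (Fin 3)) ≠ ⊤ :=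
    hV.2.eGradNormSq_lt_top.ne
  -- `meanDissipation = ν‖∇u‖²` (one period) `= (U, f_c) = ν‖∇U‖²` (energy equation)
  have h1 : meanDissipation ν (fun _ : ℝ => u) = ν * (eGradNormSq u).toReal := by
    rw [meanDissipation_eq_of_periodic (τ := 1) (fun _ => rfl) one_pos]
    simp
  have h2 : ν * (eGradNormSq (U.1 : UnitAddTorus (Fin 3) → EuclideanSpace ℝ (Fin 3))).toReal =
      pairing U.1 (force S c) :=
    IsSteadyWeakSolution.energy_eq' (by simp) (memLp_force c) hV hw
  have h3 : (eGradNormSq (U.1 : UnitAddTorus (Fin 3) → EuclideanSpace ℝ (Fin 3))).toReal =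
      gradNormSq u := by
    rw [gradNormSq_eq_toReal_eGradNormSq_holds hu]
    exact mul_left_cancel₀ hν.ne' (by rw [h2, ← hD, h1])
  rw [← ENNReal.ofReal_toReal hfin, h3]
  exact ENNReal.ofReal_le_ofReal hg

/-! ## §2 The stub -/

/-- **stub_lscInterior** (registered sub-goal, c15 wave 2).  At a point `c` of LOWER hemicontinuity of
the steady correspondence of the stratum `n`, a mean-zero classical steady witness of `c` INSIDE the
stratum (`1/(n+1) ≤ ν ≤ n`, `‖∇u‖² ≤ n²`) with STRICT budgets (`meanEnergy < E`,
`meanDissipation > ε`) at a viscosity `ν ∈ (0,a)` makes `c` an interior point of `loud S a E ε`: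
nearby forces carry nearby steady weak solutions at nearby viscosities (lower hemicontinuity), whose
classical representatives (`CensusInterior.exists_isSteadyNSState`) have nearby budgets. [folklore] -/
theorem stub_lscInterior : ∀ (S : Finset (Fin 3 → ℤ)) (n : ℕ) (a E ε : ℝ) (c : Coeff S),
    LowerHemicontinuousAt (fun c' : Coeff S =>
      {q : ℝ × energySpace (Fin 3) | 1 / ((n : ℝ) + 1) ≤ q.1 ∧ q.1 ≤ (n : ℝ) ∧
        eGradNormSq (q.2.1 : UnitAddTorus (Fin 3) → EuclideanSpace ℝ (Fin 3)) ≤ ENNReal.ofReal ((n : ℝ) ^ 2) ∧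
          Torus.IsSteadyWeakSolution q.1 (force S c') q.2}) c →
    (∃ ν : ℝ, 0 < ν ∧ ν < a ∧ 1 / ((n : ℝ) + 1) ≤ ν ∧ ν ≤ (n : ℝ) ∧
      ∃ (u : UnitAddTorus (Fin 3) → EuclideanSpace ℝ (Fin 3)) (p : UnitAddTorus (Fin 3) → ℝ),
        Torus.IsSteadyNSState ν (force S c) u p ∧ HasZeroMean u ∧ gradNormSq u ≤ (n : ℝ) ^ 2 ∧
          meanEnergy (fun _ : ℝ => u) < E ∧ ε < meanDissipation ν (fun _ : ℝ => u)) →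
    c ∈ interior (loud S a E ε) := by
  intro S n a E ε c hlsc hwit
  obtain ⟨ν, hν, hνa, hν1, hν2, u, p, hst, h0, hg, hE, hD⟩ := hwit
  -- (1) the witness as a point `(ν, U)` of the correspondence, with strict budgets
  obtain ⟨U, -, hUw, hUg, hUE, hUD⟩ := exists_weak_of_isSteadyNSState_of_gradNormSq_le hν hst h0 hg
  set F := fun c' : Coeff S => (memLp_force c').toLp (force S c')
  rw [hUE] at hE
  rw [hUD, pairing_eq_inner (memLp_force c)] at hD
  -- (2) the open set `O = (0,a) × {‖V‖² < E, ε + δ < ⟪V, f_c⟫}` meets `Φₙ(c)` at `(ν, U)`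
  obtain ⟨δ, hδ, hδD⟩ : ∃ δ : ℝ, 0 < δ ∧ ε + δ + δ < ⟪U.1, F c⟫_ℝ :=
    ⟨(⟪U.1, F c⟫_ℝ - ε) / 3, by linarith, by linarith⟩
  set O : Set (ℝ × energySpace (Fin 3)) :=
    Ioo 0 a ×ˢ ({V : energySpace (Fin 3) | ‖V‖ ^ 2 < E} ∩
      {V : energySpace (Fin 3) | ε + δ < ⟪V.1, F c⟫_ℝ}) with hO
  have hOo : IsOpen O :=
    isOpen_Ioo.prod ((isOpen_lt (continuous_norm.pow 2) continuous_const).inter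
      (isOpen_lt continuous_const (continuous_subtype_val.inner continuous_const)))
  have hUδ : ε + δ < ⟪U.1, F c⟫_ℝ := by linarith
  have hνU : ((fun c' : Coeff S =>
      {q : ℝ × energySpace (Fin 3) | 1 / ((n : ℝ) + 1) ≤ q.1 ∧ q.1 ≤ (n : ℝ) ∧
        eGradNormSq (q.2.1 : UnitAddTorus (Fin 3) → EuclideanSpace ℝ (Fin 3)) ≤
            ENNReal.ofReal ((n : ℝ) ^ 2) ∧
          Torus.IsSteadyWeakSolution q.1 (force S c') q.2}) c ∩ O).Nonempty :=
    ⟨(ν, U), ⟨hν1, hν2, hUg, hUw⟩, Set.mk_mem_prod ⟨hν, hνa⟩ ⟨hE, hUδ⟩⟩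
  -- (3) lower hemicontinuity at `c`, and continuity of `c' ↦ f_{c'}` in `L²`
  have h1 := (lowerHemicontinuousAt_iff.1 hlsc) O hOo hνU
  have hη : 0 < δ / (Real.sqrt E + 1) := by positivity
  have h2 : ∀ᶠ c' in 𝓝 c, dist (F c') (F c) < δ / (Real.sqrt E + 1) :=
    Metric.tendsto_nhds.1 ((continuous_toLp_force S).tendsto c) _ hη
  -- (4) every nearby `c'` is loud
  rw [mem_interior_iff_mem_nhds]
  filter_upwards [h1, h2] with c' hc1 hc2
  obtain ⟨⟨ν', V⟩, ⟨-, -, hVg, hVw⟩, hVO⟩ := hc1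
  simp only [hO, Set.mem_prod, Set.mem_Ioo, Set.mem_inter_iff, Set.mem_setOf_eq] at hVO
  dsimp only at hVg hVw
  obtain ⟨⟨hν'0, hν'a⟩, hVE, hVD⟩ := hVO
  have hVV : V.1 ∈ energySpaceV (Fin 3) := ⟨V.2, memSobolev_one_complexify_of_eGradNormSq_ne_top
    (Lp.memLp _) (ne_top_of_le_ne_top ENNReal.ofReal_ne_top hVg)⟩
  obtain ⟨v, q, hvst, -, hvE, hvD⟩ :=
    exists_isSteadyNSState (isSmooth_force c') (hasZeroMean_force c') hν'0 hVV hVw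
  refine ⟨ν', hν'0, hν'a, 1, fun _ => v, fun _ => q, one_pos, hvst, fun _ => rfl, ?_, ?_⟩
  · rw [hvE]
    exact hVE.le
  · rw [hvD, pairing_eq_inner (memLp_force c')]
    -- `⟪V, f_{c'}⟫ ≥ ⟪V, f_c⟫ − ‖V‖‖f_{c'} − f_c‖ > (ε + δ) − δ`
    have hcs : |⟪V.1, F c'⟫_ℝ - ⟪V.1, F c⟫_ℝ| ≤ ‖V‖ * ‖F c' - F c‖ := by
      rw [← inner_sub_right, Submodule.coe_norm]
      exact abs_real_inner_le_norm _ _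
    have hVn : ‖V‖ < Real.sqrt E := Real.lt_sqrt_of_sq_lt hVE
    have hlt : ‖V‖ * ‖F c' - F c‖ < δ := by
      rw [dist_eq_norm] at hc2
      calc ‖V‖ * ‖F c' - F c‖ ≤ ‖V‖ * (δ / (Real.sqrt E + 1)) :=
            mul_le_mul_of_nonneg_left hc2.le (norm_nonneg _)
        _ < (Real.sqrt E + 1) * (δ / (Real.sqrt E + 1)) :=
            mul_lt_mul_of_pos_right (by linarith [Real.sqrt_nonneg E]) hη
        _ = δ := by field_simp
    have hab := (abs_le.1 hcs).1
    show ε ≤ ⟪V.1, F c'⟫_ℝ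
    linarith

end Summit.AnomalousDissipation.AnomalousDissipation.Theorems.RobustLoudUpgrade.Category

end
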